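import Mathlib.Tactic.Ring
import Mathlib.Tactic.Linarith
import Literature.Computability.MetaComplexity.CuttingPlanes
import HarnessLib

/-!
# Tree-like cutting planes derivations and their linearisation

A convenience layer over `CuttingPlanes.lean` for CONSTRUCTING cutting planes refutations
(upper bounds): the inductive predicate `CPTree φ W L s` — "the line `L` has a tree-like `CP`
derivation from `φ` with `s` lines, all of `ℓ¹`-norm `≤ W`" — with one constructor per axiom
and rule, and the LINEARISATION theorem `CPTree.linearize` turning such a tree into an honest
annotated derivation (`IsCPDerivation`, a list of `CPStep`s with premise indices) of exactly
`s` lines appended to any given derivation, whence `CPTree.exists_isCPRefutation`: a tree-like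
derivation of a contradiction with `s` lines of norm `≤ W` yields a refutation `π` with
`π.length = s` and `cpNorm π ≤ W` (Cook–Coullard–Turán 1987, §2: tree-like proofs are proofs).
Used by `CuttingPlanesPigeonhole.lean`.

## References

* W. Cook, C. R. Coullard, Gy. Turán, Discrete Appl. Math. 18 (1987), §2
  [CookCoullardTuran1987].
-/

namespace Literature.Computability.MetaComplexity

open Literature.Computability.Complexity CPLine

variable {ν : Type*} [DecidableEq ν]

/-- **Tree-like derivability with size and norm**: `CPTree φ W L s` — the line `L` is derivable
from the CNF `φ` by a tree-like cutting planes derivation with `s` lines, every line of which has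
`ℓ¹`-norm at most `W`. [cite: CookCoullardTuran1987, §2] -/
inductive CPTree (φ : CNF ν) (W : ℕ) : CPLine ν → ℕ → Prop
  /-- a clause axiom -/
  | initial {C : Clause ν} (hC : C ∈ φ) (hW : (ofClause C).norm ≤ W) : CPTree φ W (ofClause C) 1
  /-- a lower bound `x ≥ 0` -/
  | lower (v : ν) (hW : (lower v).norm ≤ W) : CPTree φ W (lower v) 1
  /-- an upper bound `-x ≥ -1` -/
  | upper (v : ν) (hW : (upper v).norm ≤ W) : CPTree φ W (upper v) 1
  /-- addition -/
  | add {L M : CPLine ν} {s t : ℕ} (hL : CPTree φ W L s) (hM : CPTree φ W M t)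
      (hW : (L + M).norm ≤ W) : CPTree φ W (L + M) (s + t + 1)
  /-- multiplication by `c` -/
  | mul {L : CPLine ν} {s : ℕ} (c : ℕ) (hL : CPTree φ W L s) (hW : (smul c L).norm ≤ W) :
      CPTree φ W (smul c L) (s + 1)
  /-- division by `c > 0` dividing all coefficients -/
  | div {L : CPLine ν} {s : ℕ} (c : ℕ) (hc : 0 < c) (hd : ∀ v, (c : ℤ) ∣ L.coeff v)
      (hL : CPTree φ W L s) (hW : (divBy c L).norm ≤ W) : CPTree φ W (divBy c L) (s + 1)

namespace CPTree

variable {φ : CNF ν} {W : ℕ}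

/-- Transport along an equality of lines. [folklore] -/
theorem of_eq {L L' : CPLine ν} {s : ℕ} (h : CPTree φ W L s) (e : L = L') : CPTree φ W L' s := e ▸ h

/-- Transport along equalities of line and size. [folklore] -/
theorem of_eq_of_eq {L L' : CPLine ν} {s s' : ℕ} (h : CPTree φ W L s) (e : L = L') (e' : s = s') :
    CPTree φ W L' s' := e' ▸ e ▸ h

/-- A tree has at least one line. [folklore] -/
theorem one_le_size {L : CPLine ν} {s : ℕ} (h : CPTree φ W L s) : 1 ≤ s := by
  induction h <;> omega

/-- Every line of a tree has norm `≤ W`; in particular its conclusion. [folklore] -/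
theorem norm_le {L : CPLine ν} {s : ℕ} (h : CPTree φ W L s) : L.norm ≤ W := by
  induction h <;> assumption

end CPTree

/-! ### Appending valid steps -/

omit [DecidableEq ν] in
/-- Prefixes of an appended list. [folklore] -/
theorem take_append_of_le_length' {π ext : List (CPStep ν)} {k : ℕ} (hk : k ≤ π.length) :
    (π ++ ext).take k = π.take k := by
  rw [List.take_append_of_le_length hk]

/-- The empty derivation. [folklore] -/
theorem isCPDerivation_nil (φ : CNF ν) : IsCPDerivation φ ([] : List (CPStep ν)) :=
  fun _ hk => absurd hk (Nat.not_lt_zero _)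

/-- Appending one valid step to a derivation gives a derivation. [folklore] -/
theorem IsCPDerivation.append_step {φ : CNF ν} {π : List (CPStep ν)} (hπ : IsCPDerivation φ π)
    {st : CPStep ν} (hst : IsValidCPStep φ π st) : IsCPDerivation φ (π ++ [st]) := by
  intro k hk
  rw [List.length_append, List.length_singleton] at hk
  rcases Nat.lt_succ_iff_lt_or_eq.1 hk with h | rfl
  · rw [take_append_of_le_length' h.le, List.getElem_append_left h]
    exact hπ k h
  · rw [take_append_of_le_length' le_rfl, List.take_length, List.getElem_append_right le_rfl]
    simpa using hst

omit [DecidableEq ν] in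
/-- A derivation all of whose lines have norm `≤ W` has norm `≤ W`. [folklore] -/
theorem cpNorm_le_of_forall {π : List (CPStep ν)} {W : ℕ} (h : ∀ st ∈ π, st.line.norm ≤ W) :
    cpNorm π ≤ W := by
  unfold cpNorm
  induction π with
  | nil => exact Nat.zero_le _
  | cons st π ih =>
    rw [List.map_cons, List.foldr_cons]
    exact max_le (h st (List.mem_cons_self)) (ih fun st' hst' => h st' (List.mem_cons_of_mem _ hst'))

/-! ### Linearisation -/

/-- **Linearisation of tree-like derivations**: a tree-like derivation of `L` with `s` lines of
norm `≤ W` can be appended, as `s` annotated lines, to any derivation `pre` (of norm `≤ W`),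
ending with the line `L`. [cite: CookCoullardTuran1987, §2] -/
theorem CPTree.linearize {φ : CNF ν} {W : ℕ} {L : CPLine ν} {s : ℕ} (h : CPTree φ W L s) :
    ∀ pre : List (CPStep ν), IsCPDerivation φ pre → (∀ st ∈ pre, st.line.norm ≤ W) →
      ∃ ext : List (CPStep ν), ext.length = s ∧ IsCPDerivation φ (pre ++ ext) ∧
        (∀ st ∈ pre ++ ext, st.line.norm ≤ W) ∧
        ∃ hlt : pre.length + s - 1 < (pre ++ ext).length, ((pre ++ ext)[pre.length + s - 1]'hlt).line = L := by
  induction h with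
  | initial hC hW =>
    intro pre hpre hnorm
    refine ⟨[⟨ofClause _, .initial⟩], rfl, hpre.append_step ⟨_, hC, rfl⟩, ?_, ?_⟩
    · intro st hst
      rcases List.mem_append.1 hst with hst | hst
      · exact hnorm st hst
      · rw [List.mem_singleton] at hst; rw [hst]; exact hW
    · refine ⟨by simp, ?_⟩
      simp
  | lower v hW =>
    intro pre hpre hnorm
    refine ⟨[⟨CPLine.lower v, .lower v⟩], rfl, hpre.append_step (by unfold IsValidCPStep; rfl), ?_, ?_⟩
    · intro st hst
      rcases List.mem_append.1 hst with hst | hst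
      · exact hnorm st hst
      · rw [List.mem_singleton] at hst; rw [hst]; exact hW
    · refine ⟨by simp, ?_⟩
      simp
  | upper v hW =>
    intro pre hpre hnorm
    refine ⟨[⟨CPLine.upper v, .upper v⟩], rfl, hpre.append_step (by unfold IsValidCPStep; rfl), ?_, ?_⟩
    · intro st hst
      rcases List.mem_append.1 hst with hst | hst
      · exact hnorm st hst
      · rw [List.mem_singleton] at hst; rw [hst]; exact hW
    · refine ⟨by simp, ?_⟩
      simp
  | @add L M s t hL hM hW ihL ihM =>
    intro pre hpre hnorm
    have hs := hL.one_le_size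
    have ht := hM.one_le_size
    obtain ⟨e1, he1, hd1, hn1, hlt1, hL1⟩ := ihL pre hpre hnorm
    obtain ⟨e2, he2, hd2, hn2, hlt2, hM2⟩ := ihM (pre ++ e1) hd1 hn1
    -- indices of the two premises in `pre ++ e1 ++ e2`
    set i := pre.length + s - 1 with hi
    set j := (pre ++ e1).length + t - 1 with hj
    have hlen12 : (pre ++ e1 ++ e2).length = pre.length + s + t := by simp [he1, he2]; ring
    have hi' : i < (pre ++ e1 ++ e2).length := by rw [hlen12]; omega
    have hj' : j < (pre ++ e1 ++ e2).length := hlt2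
    have hLi : ((pre ++ e1 ++ e2)[i]'hi').line = L := by
      rw [List.getElem_append_left hlt1]; exact hL1
    have hMj : ((pre ++ e1 ++ e2)[j]'hj').line = M := hM2
    let st : CPStep ν := ⟨L + M, .add i j⟩
    have hstl : st.line = L + M := rfl
    have hval : IsValidCPStep φ (pre ++ e1 ++ e2) st := ⟨hi', hj', by rw [hstl, hLi, hMj]⟩
    refine ⟨e1 ++ e2 ++ [st], by simp [he1, he2]; ring, ?_, ?_, ?_⟩
    · have := hd2.append_step hval
      simpa [List.append_assoc] using this
    · intro st' hst'
      simp only [List.append_assoc, List.mem_append, List.mem_singleton] at hst'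
      rcases hst' with hst' | hst' | hst' | rfl
      · exact hnorm st' hst'
      · exact hn1 st' (List.mem_append_right _ hst')
      · exact hn2 st' (List.mem_append_right _ hst')
      · exact hW
    · have hlen : (pre ++ (e1 ++ e2 ++ [st])).length = pre.length + s + t + 1 := by
        simp [he1, he2]; ring
      refine ⟨by rw [hlen]; omega, ?_⟩
      have hidx : pre.length + (s + t + 1) - 1 = (pre ++ e1 ++ e2).length := by rw [hlen12]; omega
      simp only [hidx, ← List.append_assoc]
      rw [List.getElem_append_right le_rfl]
      simp [hstl]
  | @mul L s c hL hW ih =>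
    intro pre hpre hnorm
    have hs := hL.one_le_size
    obtain ⟨e1, he1, hd1, hn1, hlt1, hL1⟩ := ih pre hpre hnorm
    set i := pre.length + s - 1 with hi
    let st : CPStep ν := ⟨smul c L, .mul c i⟩
    have hstl : st.line = smul c L := rfl
    have hval : IsValidCPStep φ (pre ++ e1) st := ⟨hlt1, by rw [hstl, hL1]⟩
    refine ⟨e1 ++ [st], by simp [he1], ?_, ?_, ?_⟩
    · have := hd1.append_step hval
      simpa [List.append_assoc] using this
    · intro st' hst'
      simp only [List.mem_append, List.mem_singleton] at hst'
      rcases hst' with hst' | hst' | rfl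
      · exact hnorm st' hst'
      · exact hn1 st' (List.mem_append_right _ hst')
      · exact hW
    · have hlen1 : (pre ++ e1).length = pre.length + s := by simp [he1]
      have hlen : (pre ++ (e1 ++ [st])).length = pre.length + s + 1 := by simp [he1]; ring
      refine ⟨by rw [hlen]; omega, ?_⟩
      have hidx : pre.length + (s + 1) - 1 = (pre ++ e1).length := by rw [hlen1]; omega
      simp only [hidx, ← List.append_assoc]
      rw [List.getElem_append_right le_rfl]
      simp [hstl]
  | @div L s c hc hd hL hW ih =>
    intro pre hpre hnorm
    have hs := hL.one_le_size
    obtain ⟨e1, he1, hd1, hn1, hlt1, hL1⟩ := ih pre hpre hnorm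
    set i := pre.length + s - 1 with hi
    let st : CPStep ν := ⟨divBy c L, .div c i⟩
    have hstl : st.line = divBy c L := rfl
    have hval : IsValidCPStep φ (pre ++ e1) st := ⟨hlt1, hc, by rw [hL1]; exact hd, by rw [hstl, hL1]⟩
    refine ⟨e1 ++ [st], by simp [he1], ?_, ?_, ?_⟩
    · have := hd1.append_step hval
      simpa [List.append_assoc] using this
    · intro st' hst'
      simp only [List.mem_append, List.mem_singleton] at hst'
      rcases hst' with hst' | hst' | rfl
      · exact hnorm st' hst'
      · exact hn1 st' (List.mem_append_right _ hst')
      · exact hW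
    · have hlen1 : (pre ++ e1).length = pre.length + s := by simp [he1]
      have hlen : (pre ++ (e1 ++ [st])).length = pre.length + s + 1 := by simp [he1]; ring
      refine ⟨by rw [hlen]; omega, ?_⟩
      have hidx : pre.length + (s + 1) - 1 = (pre ++ e1).length := by rw [hlen1]; omega
      simp only [hidx, ← List.append_assoc]
      rw [List.getElem_append_right le_rfl]
      simp [hstl]

/-- **A tree-like derivation of a contradiction is a refutation** of the same size and norm:
if `0 ≥ b`, `b > 0`, has a tree-like `CP` derivation from `φ` with `s` lines of norm `≤ W`, then
`φ` has a cutting planes refutation `π` with `π.length = s` and `cpNorm π ≤ W`.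
[cite: CookCoullardTuran1987, §2] -/
theorem CPTree.exists_isCPRefutation {φ : CNF ν} {W : ℕ} {L : CPLine ν} {s : ℕ}
    (h : CPTree φ W L s) (hL : L.IsContradiction) :
    ∃ π : List (CPStep ν), IsCPRefutation φ π ∧ π.length = s ∧ cpNorm π ≤ W := by
  obtain ⟨ext, hlen, hder, hnorm, hlt, hlast⟩ :=
    h.linearize [] (isCPDerivation_nil φ) (fun _ h => by simp at h)
  simp only [List.nil_append, List.length_nil, Nat.zero_add] at hder hnorm hlt hlast hlen
  refine ⟨ext, ⟨hder, ext[s - 1]'hlt, List.getElem_mem hlt, by rw [hlast]; exact hL⟩, hlen,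
    cpNorm_le_of_forall hnorm⟩

end Literature.Computability.MetaComplexity
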